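import Literature.MathematicalPhysics.QuantumLattice.HubbardUVShiftedSymbolSmooth
import Literature.MathematicalPhysics.QuantumLattice.HubbardUVSymbolCTDifferences
import Literature.MathematicalPhysics.QuantumLattice.HubbardUVBlockDetBound
import HarnessLib

/-!
# Second differences of the padded SHIFTED ultraviolet-block symbol `w_{Λ₀}·p_θ` on the space–time dual torus — the `ℓ²` inputs of
# the row sums of the block above the infrared scale, uniform in `M`

Topic `MathematicalPhysics/QuantumLattice`; the `θ ≠ 0` (Hartree-shifted, complex chemical potential) twin of `HubbardUVSymbolCTDifferences`
(cell gate-hubbard-kl, R0-SCOPE-4 W2e-b).  The covariance above the infrared scale `Λ₀` of the shifted decomposition,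
`top + uv = normalCovariance (uvShiftedSymbol …)` (`hubbardCovTopShifted_add_uv_eq_normalCovariance`), symbol `w_{Λ₀}(k)·βL²/(-i(ω+θ)+ξ(k⃗))`,
pulled back to the `N`-point time grid has the padded symbol `G(q₀,q⃗) = (βL²)⁻² Ψ_{ξ(q⃗)}(ω̃_{q₀})` for `val q₀ < 2M`, `0` beyond
(`Ψ = uvShiftedSymbolFn`, `HubbardUVShiftedSymbolSmooth`).  As in the counterterm twin the padding is a genuine jump at the four edge points
(bounded by the edge values `5(βL²)⁻¹β/(π(2M-3))`), the interior second differences are controlled by `‖Ψ″‖ ≤ K βL²/(Λ₀(ω²+ξ²+Λ₀²))` and the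
step condition `4π/β ≤ Λ₀` (on `[ω̃, ω̃+4π/β]` the weight `1/(t²+Λ₀²)` changes at most by the factor `5`), and the `ℓ²` sums are Matsubara
sums `Σ_i 1/(ω_i²+Λ₀²) ≤ β/(2Λ₀)` (`sum_matsubaraIdx_inv_sq_add_sq_le`), uniform in `M`.

Main results (`G = gridSymbol L M N β (uvShiftedSymbol L M β μ θ Λ₀) σ`; `0 < β`, `|βθ| ≤ π/4`, `π/β ≤ Λ₀ ≤ 1`, `2M ≤ N`):
* `uvShiftedSymbol`, `hubbardCovTopShifted_add_uv_eq_normalCovariance`, `gridSymbol_uvShiftedSymbol_eq`, `norm_sq_gridSymbol_uvShiftedSymbol_le`,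
  `norm_gridSymbol_uvShiftedSymbol_le_edge`;
* `sq_add_sq_le_five_mul` (the factor-`5` step lemma), `sum_matsubaraIdx_inv_sq_add_sq_sq_le` (`Σ_i 1/(ω_i²+Λ₀²)² ≤ β/(2Λ₀³)`);
* time: `fwdDiff_two_time_gridSymbol_uvShifted_eq`, `norm_fwdDiff_two_time_gridSymbol_uvShifted_le_interior` (`4π/β ≤ Λ₀`), `…_le_edge`,
  `…_eq_zero_of_padding`, **`sum_norm_sq_fwdDiff_two_time_uvShifted_le`**;
* space: `gridSymbol_uvShiftedSymbol_add_smul_eq`, `fwdDiff_two_space_gridSymbol_uvShifted_eq`, `norm_fwdDiff_two_space_gridSymbol_uvShifted_le`,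
  **`sum_norm_sq_fwdDiff_two_space_uvShifted_le`**;
* **`sum_norm_sq_gridSymbol_uvShiftedSymbol_le`**.

Everything is proved; `uvShiftedSymbol` is the only definition; no named facts.

## Sources

G. Benfatto, A. Giuliani, V. Mastropietro, Ann. Henri Poincaré 7 (2006) 809–898, §2.1 (2.3), (2.36aa), App. A1 (`BenfattoGiulianiMastropietro2006`);
M. Salmhofer, *Renormalization* (1999), §4.2.4–4.2.5 (4.63), (4.70) (`Salmhofer1999`).
-/

noncomputable section

namespace Literature.MathematicalPhysics.QuantumLattice

open Literature.Probability.LatticeModels GrassmannAlgebra Finset Complex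

/-- The symbol of the block above the infrared scale: `w_{Λ₀}(k)·p_θ(k,σ)`. [cite: Salmhofer1999, §4.2.5 (4.70)] -/
def uvShiftedSymbol (L M : ℕ) [NeZero L] (β μ θ Λ₀ : ℝ) (ks : FreqMomentum L M × Fin 2) : ℂ :=
  ((hubbardCutoffWeight L M β μ Λ₀ ks.1 : ℝ) : ℂ) * shiftedFreeSymbol L M β μ θ ks

variable {L M N : ℕ}

/-! ### The symbol and its padded pull-back -/

section Symbol

variable [NeZero L] [NeZero N]

omit [NeZero N] in
/-- **`top + uv = normalCovariance (w_{Λ₀}·p_θ)`.** [cite: Salmhofer1999, §4.2.5 (4.70)–(4.73)] -/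
theorem hubbardCovTopShifted_add_uv_eq_normalCovariance (β μ θ Λ₀ : ℝ) :
    hubbardCovTopShifted L M β μ θ + hubbardCovUVShifted L M β μ θ Λ₀ = normalCovariance L M (uvShiftedSymbol L M β μ θ Λ₀) := by
  rw [hubbardCovTopShifted_add_uv_eq, ← normalCovariance_sub_symbol]
  congr 1
  funext ks
  simp only [uvShiftedSymbol]
  push_cast
  ring

omit [NeZero N] in
/-- **The padded grid symbol**: `(βL²)⁻² Ψ_{ξ(q⃗)}(ω̃_{q₀})` if `val q₀ < 2M`, else `0` (`0 < β`, `|βθ| ≤ π/4`).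
[cite: BenfattoGiulianiMastropietro2006, §2.1 (2.3)] -/
theorem gridSymbol_uvShiftedSymbol_eq {β : ℝ} (hβ : 0 < β) (μ : ℝ) {θ : ℝ} (hθ : |β * θ| ≤ Real.pi / 4) (Λ₀ : ℝ) (σ : Fin 2)
    (q₀ : TorusSite 1 N) (qv : TorusSite 2 L) :
    gridSymbol L M N β (uvShiftedSymbol L M β μ θ Λ₀) σ q₀ qv =
      if (q₀ 0).val < 2 * M then ((1 / (β * (L : ℝ) ^ 2) : ℝ) : ℂ) ^ 2 *
        uvShiftedSymbolFn (β * (L : ℝ) ^ 2) θ Λ₀ (nambuXi L μ qv) (gridFreq M N β q₀) else 0 := by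
  unfold gridSymbol
  split_ifs with h
  · rw [uvShiftedSymbol, uvShiftedSymbol_eq_uvShiftedSymbolFn hβ μ hθ, matsubaraFreq_eq_gridFreq β q₀ h]
  · rfl

omit [NeZero N] in
/-- **`‖G(q₀,q⃗)‖² ≤ [val q₀ < 2M]·(βL²)⁻⁴·20(βL²)²/(ω̃²+Λ₀²)`** (`π/β ≤ Λ₀`, so `|θ| ≤ Λ₀/4`). [cite: BenfattoGiulianiMastropietro2006, App. A1] -/
theorem norm_sq_gridSymbol_uvShiftedSymbol_le {β : ℝ} (hβ : 0 < β) (μ : ℝ) {θ : ℝ} (hθ : |β * θ| ≤ Real.pi / 4) {Λ₀ : ℝ}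
    (hΛ₀β : Real.pi / β ≤ Λ₀) (σ : Fin 2) (q₀ : TorusSite 1 N) (qv : TorusSite 2 L) :
    ‖gridSymbol L M N β (uvShiftedSymbol L M β μ θ Λ₀) σ q₀ qv‖ ^ 2 ≤
      if (q₀ 0).val < 2 * M then
        ((1 / (β * (L : ℝ) ^ 2)) ^ 2) ^ 2 * (20 * (β * (L : ℝ) ^ 2) ^ 2 / (gridFreq M N β q₀ ^ 2 + Λ₀ ^ 2)) else 0 := by
  have hΛ₀ : 0 < Λ₀ := lt_of_lt_of_le (by positivity) hΛ₀β
  have hθ' : |θ| ≤ Λ₀ / 4 := abs_shift_le_quarter hβ hθ hΛ₀β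
  rw [gridSymbol_uvShiftedSymbol_eq hβ μ hθ]
  split_ifs with h
  · rw [norm_mul, mul_pow, norm_pow, Complex.norm_real, Real.norm_eq_abs, abs_of_nonneg (by positivity)]
    refine mul_le_mul_of_nonneg_left ((norm_sq_uvShiftedSymbolFn_le hΛ₀ hθ' (by positivity) _).trans ?_) (by positivity)
    exact div_le_div_of_nonneg_left (by positivity) (by positivity) (by nlinarith [sq_nonneg (nambuXi L μ qv)])
  · rw [norm_zero, zero_pow two_ne_zero]

omit [NeZero L] [NeZero N] in
/-- `‖z‖² ≤ A²` with `0 ≤ A` gives `‖z‖ ≤ A`. [folklore] -/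
private theorem norm_le_of_sq_le {z : ℂ} {A : ℝ} (hA : 0 ≤ A) (h : ‖z‖ ^ 2 ≤ A ^ 2) : ‖z‖ ≤ A :=
  (pow_le_pow_iff_left₀ (norm_nonneg z) hA two_ne_zero).1 h

omit [NeZero N] in
/-- **At the edge frequencies** (`val q₀ ≤ 1` or `2M-2 ≤ val q₀`, `2 ≤ M`): `‖G(q₀,q⃗)‖ ≤ (βL²)⁻²·5βL²·β/(π(2M-3))`
(`‖Ψ‖ ≤ √20 c/|ω̃| ≤ 5cβ/(π(2M-3))`, or `0`). [cite: BenfattoGiulianiMastropietro2006, §2.1 (2.3)] -/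
theorem norm_gridSymbol_uvShiftedSymbol_le_edge {β : ℝ} (hβ : 0 < β) (μ : ℝ) {θ : ℝ} (hθ : |β * θ| ≤ Real.pi / 4) {Λ₀ : ℝ}
    (hΛ₀β : Real.pi / β ≤ Λ₀) (hM : 2 ≤ M) (σ : Fin 2) (q₀ : TorusSite 1 N) (qv : TorusSite 2 L)
    (hq : (q₀ 0).val ≤ 1 ∨ 2 * M - 2 ≤ (q₀ 0).val) :
    ‖gridSymbol L M N β (uvShiftedSymbol L M β μ θ Λ₀) σ q₀ qv‖ ≤
      (1 / (β * (L : ℝ) ^ 2)) ^ 2 * (5 * (β * (L : ℝ) ^ 2) * (β / (Real.pi * (2 * M - 3)))) := by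
  have hM' : (0 : ℝ) < 2 * M - 3 := by
    have : (2 : ℝ) ≤ M := by exact_mod_cast hM
    linarith
  have hfreq := abs_gridFreq_ge (M := M) hβ q₀ hq
  have hωpos : 0 < |gridFreq M N β q₀| := lt_of_lt_of_le (by positivity) hfreq
  refine norm_le_of_sq_le (by positivity) ((norm_sq_gridSymbol_uvShiftedSymbol_le hβ μ hθ hΛ₀β σ q₀ qv).trans ?_)
  split_ifs with h
  · -- `20c²/(ω̃²+Λ₀²) ≤ 25c²/ω̃² ≤ (5cβ/(π(2M-3)))²`
    have hL : (0 : ℝ) < L := by exact_mod_cast Nat.pos_of_ne_zero (NeZero.ne L)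
    have hω2 : 0 < gridFreq M N β q₀ ^ 2 := by rw [← sq_abs]; positivity
    have h1 : 20 * (β * (L : ℝ) ^ 2) ^ 2 / (gridFreq M N β q₀ ^ 2 + Λ₀ ^ 2) ≤ 25 * (β * (L : ℝ) ^ 2) ^ 2 / gridFreq M N β q₀ ^ 2 := by
      rw [div_le_div_iff₀ (by positivity) hω2]; nlinarith [sq_nonneg (β * (L : ℝ) ^ 2 * Λ₀), sq_nonneg (gridFreq M N β q₀)]
    have h2 : 25 * (β * (L : ℝ) ^ 2) ^ 2 / gridFreq M N β q₀ ^ 2 ≤ (5 * (β * (L : ℝ) ^ 2) * (β / (Real.pi * (2 * M - 3)))) ^ 2 := by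
      rw [show (5 * (β * (L : ℝ) ^ 2) * (β / (Real.pi * (2 * M - 3)))) ^ 2 =
          25 * (β * (L : ℝ) ^ 2) ^ 2 / (Real.pi * (2 * M - 3) / β) ^ 2 by field_simp; ring]
      refine div_le_div_of_nonneg_left (by positivity) (by positivity) ?_
      rw [← sq_abs (gridFreq M N β q₀)]
      exact pow_le_pow_left₀ (by positivity) hfreq 2
    calc ((1 / (β * (L : ℝ) ^ 2)) ^ 2) ^ 2 * (20 * (β * (L : ℝ) ^ 2) ^ 2 / (gridFreq M N β q₀ ^ 2 + Λ₀ ^ 2))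
        ≤ ((1 / (β * (L : ℝ) ^ 2)) ^ 2) ^ 2 * (5 * (β * (L : ℝ) ^ 2) * (β / (Real.pi * (2 * M - 3)))) ^ 2 :=
          mul_le_mul_of_nonneg_left (h1.trans h2) (by positivity)
      _ = _ := by ring
  · positivity

end Symbol

/-! ### The step lemma and the Matsubara sum -/

/-- **The factor-`5` step lemma**: `|t - ω| ≤ Λ₀` gives `ω² + Λ₀² ≤ 5(t² + Λ₀²)`. [cite: BenfattoGiulianiMastropietro2006, (2.36aa)] -/
theorem sq_add_sq_le_five_mul {Λ₀ ω t : ℝ} (h : |t - ω| ≤ Λ₀) : ω ^ 2 + Λ₀ ^ 2 ≤ 5 * (t ^ 2 + Λ₀ ^ 2) := by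
  rw [abs_le] at h
  nlinarith [sq_nonneg (t + ω), sq_nonneg (2 * t - ω), sq_abs ω, sq_nonneg (ω - 2 * (t - ω)), sq_nonneg (t - ω)]

/-- **`Σ_i 1/(ω_i²+Λ₀²)² ≤ β/(2Λ₀³)`** (`0 < β`, `0 < Λ₀`), uniformly in `M`. [cite: BenfattoGiulianiMastropietro2006, §2.1 (2.2)–(2.5)] -/
theorem sum_matsubaraIdx_inv_sq_add_sq_sq_le {β Λ₀ : ℝ} (hβ : 0 < β) (hΛ₀ : 0 < Λ₀) (M : ℕ) :
    ∑ i : MatsubaraIdx M, 1 / (matsubaraFreq β M i ^ 2 + Λ₀ ^ 2) ^ 2 ≤ β / (2 * Λ₀ ^ 3) := by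
  have hterm : ∀ i : MatsubaraIdx M, 1 / (matsubaraFreq β M i ^ 2 + Λ₀ ^ 2) ^ 2 ≤
      1 / Λ₀ ^ 2 * (1 / (matsubaraFreq β M i ^ 2 + Λ₀ ^ 2)) := by
    intro i
    rw [one_div_mul_one_div, sq]
    exact one_div_le_one_div_of_le (by positivity) (mul_le_mul_of_nonneg_right (by nlinarith [sq_nonneg (matsubaraFreq β M i)])
      (by positivity))
  refine (sum_le_sum fun i _ => hterm i).trans ?_
  rw [← mul_sum]
  refine (mul_le_mul_of_nonneg_left (sum_matsubaraIdx_inv_sq_add_sq_le hβ hΛ₀ M) (by positivity)).trans (le_of_eq ?_)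
  field_simp

/-! ### The time direction -/

section Time

variable [NeZero L] [NeZero N] {β μ θ Λ₀ : ℝ}

/-- **The second time difference of the padded symbol in the interior** (`val q₀ + 2 < 2M ≤ N`).
[cite: BenfattoGiulianiMastropietro2006, (2.36aa)] -/
theorem fwdDiff_two_time_gridSymbol_uvShifted_eq (hβ : 0 < β) (hθ : |β * θ| ≤ Real.pi / 4) (hMN : 2 * M ≤ N) (σ : Fin 2)
    (q₀ : TorusSite 1 N) (qv : TorusSite 2 L) (h : (q₀ 0).val + 2 < 2 * M) :
    (fwdDiff (fun _ : Fin 1 => (1 : ZMod N)))^[2] (fun q => gridSymbol L M N β (uvShiftedSymbol L M β μ θ Λ₀) σ q qv) q₀ =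
      ((1 / (β * (L : ℝ) ^ 2) : ℝ) : ℂ) ^ 2 *
        (uvShiftedSymbolFn (β * (L : ℝ) ^ 2) θ Λ₀ (nambuXi L μ qv) (gridFreq M N β q₀ + 2 * (2 * Real.pi / β)) -
          (2 : ℝ) • uvShiftedSymbolFn (β * (L : ℝ) ^ 2) θ Λ₀ (nambuXi L μ qv) (gridFreq M N β q₀ + 2 * Real.pi / β) +
          uvShiftedSymbolFn (β * (L : ℝ) ^ 2) θ Λ₀ (nambuXi L μ qv) (gridFreq M N β q₀)) := by
  have h0 : (q₀ 0).val < 2 * M := by omega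
  have h1N : (q₀ 0).val + 1 < N := by omega
  have h2N : (q₀ 0).val + 2 < N := by omega
  have hv1 : ((q₀ + 1 • (fun _ : Fin 1 => (1 : ZMod N))) 0).val < 2 * M := by
    rw [val_add_smul_timeStep q₀ (by omega), Nat.mod_eq_of_lt h1N]; omega
  have hv2 : ((q₀ + 2 • (fun _ : Fin 1 => (1 : ZMod N))) 0).val < 2 * M := by
    rw [val_add_smul_timeStep q₀ (by omega), Nat.mod_eq_of_lt h2N]; omega
  rw [fwdDiff_iter_two_apply, gridSymbol_uvShiftedSymbol_eq hβ μ hθ, gridSymbol_uvShiftedSymbol_eq hβ μ hθ,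
    gridSymbol_uvShiftedSymbol_eq hβ μ hθ, if_pos hv2, if_pos hv1, if_pos h0, gridFreq_add_smul β q₀ 2 h2N, gridFreq_add_smul β q₀ 1 h1N]
  push_cast
  rw [one_mul, Complex.real_smul]
  push_cast
  ring

/-- **Interior bound**: `‖(Δ_u)² G(·,q⃗)(q₀)‖ ≤ (βL²)⁻²·(2π/β)²·5K·βL²/(Λ₀(ω̃²+Λ₀²))`, `K = 32B₂+144B₁+200`, for `val q₀ + 2 < 2M ≤ N`,
`π/β ≤ Λ₀`, `4π/β ≤ Λ₀` (mean value twice; on the two steps the weight moves by at most the factor `5`).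
[cite: BenfattoGiulianiMastropietro2006, (2.36aa)] -/
theorem norm_fwdDiff_two_time_gridSymbol_uvShifted_le_interior (hβ : 0 < β) (hθ : |β * θ| ≤ Real.pi / 4) (hΛ₀β : Real.pi / β ≤ Λ₀)
    (hstep : 2 * (2 * Real.pi / β) ≤ Λ₀) {B₁ B₂ : ℝ} (hB₁ : ∀ x, |deriv salmhoferCutoff x| ≤ B₁)
    (hB₂ : ∀ x, |deriv (deriv salmhoferCutoff) x| ≤ B₂) (hMN : 2 * M ≤ N) (σ : Fin 2) (q₀ : TorusSite 1 N) (qv : TorusSite 2 L)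
    (h : (q₀ 0).val + 2 < 2 * M) :
    ‖(fwdDiff (fun _ : Fin 1 => (1 : ZMod N)))^[2] (fun q => gridSymbol L M N β (uvShiftedSymbol L M β μ θ Λ₀) σ q qv) q₀‖ ≤
      (1 / (β * (L : ℝ) ^ 2)) ^ 2 * ((2 * Real.pi / β) ^ 2 *
        (5 * (32 * B₂ + 144 * B₁ + 200) * (β * (L : ℝ) ^ 2) / (Λ₀ * (gridFreq M N β q₀ ^ 2 + Λ₀ ^ 2)))) := by
  have hΛ₀ : 0 < Λ₀ := lt_of_lt_of_le (by positivity) hΛ₀β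
  have hθ' : |θ| ≤ Λ₀ / 4 := abs_shift_le_quarter hβ hθ hΛ₀β
  have hB10 : 0 ≤ B₁ := (abs_nonneg _).trans (hB₁ 0)
  have hB20 : 0 ≤ B₂ := (abs_nonneg _).trans (hB₂ 0)
  set ω := gridFreq M N β q₀ with hω
  set c := β * (L : ℝ) ^ 2 with hc
  set ξ := nambuXi L μ qv with hξ
  have hc0 : 0 ≤ c := by positivity
  rw [fwdDiff_two_time_gridSymbol_uvShifted_eq hβ hθ hMN σ q₀ qv h, norm_mul, norm_pow, Complex.norm_real, Real.norm_eq_abs,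
    abs_of_nonneg (by positivity), ← hω, ← hc, ← hξ]
  refine mul_le_mul_of_nonneg_left ?_ (by positivity)
  refine Literature.Analysis.norm_second_difference_le (δ := 2 * Real.pi / β) (by positivity)
    (fun t _ => hasDerivAt_uvShiftedSymbolFn (c := c) (ξ := ξ) hΛ₀ hθ' t)
    (fun t _ => hasDerivAt_uvShiftedSymbolFnD1 (c := c) (ξ := ξ) hΛ₀ hθ' t) fun t ht => ?_
  refine (norm_uvShiftedSymbolFnD2_le hΛ₀ hθ' hc0 hB₁ hB₂ t).trans ?_
  -- `1/(t²+ξ²+Λ₀²) ≤ 5/(ω²+Λ₀²)` on `[ω, ω+2δ]`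
  have h5 : ω ^ 2 + Λ₀ ^ 2 ≤ 5 * (t ^ 2 + Λ₀ ^ 2) :=
    sq_add_sq_le_five_mul (by rw [abs_of_nonneg (by linarith [ht.1])]; linarith [ht.2])
  rw [div_le_div_iff₀ (by positivity) (by positivity)]
  have hK : 0 ≤ (32 * B₂ + 144 * B₁ + 200) * c := by positivity
  nlinarith [mul_le_mul_of_nonneg_left h5 (mul_nonneg hK hΛ₀.le), sq_nonneg ξ, mul_nonneg (mul_nonneg hK hΛ₀.le) (sq_nonneg ξ)]

/-- **The non-interior second time differences are edge-sized**: for `2M ≤ val q₀ + 2` (`2 ≤ M`, `2M ≤ N`),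
`‖(Δ_u)² G(·,q⃗)(q₀)‖ ≤ 4·(βL²)⁻²·5βL²·β/(π(2M-3))`. [cite: BenfattoGiulianiMastropietro2006, (2.36aa)] -/
theorem norm_fwdDiff_two_time_gridSymbol_uvShifted_le_edge (hβ : 0 < β) (hθ : |β * θ| ≤ Real.pi / 4) (hΛ₀β : Real.pi / β ≤ Λ₀)
    (hM : 2 ≤ M) (hMN : 2 * M ≤ N) (σ : Fin 2) (q₀ : TorusSite 1 N) (qv : TorusSite 2 L) (h : 2 * M ≤ (q₀ 0).val + 2) :
    ‖(fwdDiff (fun _ : Fin 1 => (1 : ZMod N)))^[2] (fun q => gridSymbol L M N β (uvShiftedSymbol L M β μ θ Λ₀) σ q qv) q₀‖ ≤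
      4 * ((1 / (β * (L : ℝ) ^ 2)) ^ 2 * (5 * (β * (L : ℝ) ^ 2) * (β / (Real.pi * (2 * M - 3))))) := by
  set E := (1 / (β * (L : ℝ) ^ 2)) ^ 2 * (5 * (β * (L : ℝ) ^ 2) * (β / (Real.pi * (2 * M - 3)))) with hE
  have hval : ∀ m : ℕ, m ≤ 2 → ((q₀ + m • (fun _ : Fin 1 => (1 : ZMod N))) 0).val ≤ 1 ∨
      2 * M - 2 ≤ ((q₀ + m • (fun _ : Fin 1 => (1 : ZMod N))) 0).val := by
    intro m hm
    have hmN : m < N := by omega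
    have hv := (q₀ 0).val_lt
    rw [val_add_smul_timeStep q₀ hmN]
    by_cases hlt : (q₀ 0).val + m < N
    · rw [Nat.mod_eq_of_lt hlt]; right; omega
    · left
      rw [not_lt] at hlt
      have : ((q₀ 0).val + m) % N = (q₀ 0).val + m - N := by
        rw [Nat.mod_eq_sub_mod hlt, Nat.mod_eq_of_lt (by omega)]
      rw [this]; omega
  have hpt : ∀ m : ℕ, m ≤ 2 →
      ‖gridSymbol L M N β (uvShiftedSymbol L M β μ θ Λ₀) σ (q₀ + m • (fun _ : Fin 1 => (1 : ZMod N))) qv‖ ≤ E := fun m hm =>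
    norm_gridSymbol_uvShiftedSymbol_le_edge hβ μ hθ hΛ₀β hM σ _ qv (hval m hm)
  have h0 := hpt 0 (by norm_num)
  rw [zero_smul, add_zero] at h0
  rw [fwdDiff_iter_two_apply]
  calc _ ≤ ‖gridSymbol L M N β (uvShiftedSymbol L M β μ θ Λ₀) σ (q₀ + 2 • fun _ : Fin 1 => (1 : ZMod N)) qv -
          (2 : ℤ) • gridSymbol L M N β (uvShiftedSymbol L M β μ θ Λ₀) σ (q₀ + 1 • fun _ : Fin 1 => (1 : ZMod N)) qv‖ +
        ‖gridSymbol L M N β (uvShiftedSymbol L M β μ θ Λ₀) σ q₀ qv‖ := norm_add_le _ _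
    _ ≤ (E + 2 * E) + E := by
        refine add_le_add ((norm_sub_le _ _).trans (add_le_add (hpt 2 le_rfl) ?_)) h0
        rw [zsmul_eq_mul, norm_mul, Int.cast_ofNat, Complex.norm_ofNat]
        exact mul_le_mul_of_nonneg_left (hpt 1 (by norm_num)) (by norm_num)
    _ = 4 * E := by ring

omit [NeZero L] in
/-- **In the padding the second time differences vanish** (`2M ≤ val q₀`, `val q₀ + 2 < N`). [cite: BenfattoGiulianiMastropietro2006, (2.36aa)] -/
theorem fwdDiff_two_time_gridSymbol_uvShifted_eq_zero_of_padding [NeZero L] (σ : Fin 2) (q₀ : TorusSite 1 N) (qv : TorusSite 2 L)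
    (h1 : 2 * M ≤ (q₀ 0).val) (h2 : (q₀ 0).val + 2 < N) :
    (fwdDiff (fun _ : Fin 1 => (1 : ZMod N)))^[2] (fun q => gridSymbol L M N β (uvShiftedSymbol L M β μ θ Λ₀) σ q qv) q₀ = 0 := by
  have hz : ∀ m : ℕ, m ≤ 2 → gridSymbol L M N β (uvShiftedSymbol L M β μ θ Λ₀) σ (q₀ + m • (fun _ : Fin 1 => (1 : ZMod N))) qv = 0 := by
    intro m hm
    have hv : ¬ ((q₀ + m • (fun _ : Fin 1 => (1 : ZMod N))) 0).val < 2 * M := by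
      rw [val_add_smul_timeStep q₀ (by omega), Nat.mod_eq_of_lt (by omega)]; omega
    unfold gridSymbol
    rw [dif_neg hv]
  have h0 := hz 0 (by norm_num)
  rw [zero_smul, add_zero] at h0
  rw [fwdDiff_iter_two_apply, hz 2 le_rfl, hz 1 (by norm_num), h0]
  simp

end Time

/-! ### The space direction -/

section Space

variable [NeZero L] [NeZero N] {β μ θ Λ₀ : ℝ}

omit [NeZero N] in
/-- **The padded symbol along a momentum shift**: `G(q₀, q⃗ + m e_l)` is `Φ` at `p_l + m·2π/L` (or `0` beyond the window).
[cite: BenfattoGiulianiMastropietro2006, §2.2 (2.10)] -/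
theorem gridSymbol_uvShiftedSymbol_add_smul_eq (hβ : 0 < β) (hθ : |β * θ| ≤ Real.pi / 4) (σ : Fin 2) (q₀ : TorusSite 1 N)
    (qv : TorusSite 2 L) (l : Fin 2) (m : ℕ) :
    gridSymbol L M N β (uvShiftedSymbol L M β μ θ Λ₀) σ q₀ (qv + m • (Pi.single l (1 : ZMod L) : TorusSite 2 L)) =
      if (q₀ 0).val < 2 * M then ((1 / (β * (L : ℝ) ^ 2) : ℝ) : ℂ) ^ 2 *
        uvShiftedMomentumSymbolFn (β * (L : ℝ) ^ 2) θ Λ₀ (gridFreq M N β q₀) (nambuXi L μ qv + 2 * Real.cos (latticeMomentum L qv l))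
          (latticeMomentum L qv l + m * (2 * Real.pi / L)) else 0 := by
  unfold gridSymbol
  split_ifs with h
  · rw [uvShiftedSymbol, uvShiftedSymbol_shift_eq_uvShiftedMomentumSymbolFn hβ μ hθ, matsubaraFreq_eq_gridFreq β q₀ h]
  · rfl

omit [NeZero N] in
/-- **The second space difference of the padded symbol** is the second difference of `Φ` at step `2π/L` (or `0`).
[cite: BenfattoGiulianiMastropietro2006, (2.36aa)] -/
theorem fwdDiff_two_space_gridSymbol_uvShifted_eq (hβ : 0 < β) (hθ : |β * θ| ≤ Real.pi / 4) (σ : Fin 2) (q₀ : TorusSite 1 N)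
    (qv : TorusSite 2 L) (l : Fin 2) :
    (fwdDiff (Pi.single l (1 : ZMod L) : TorusSite 2 L))^[2] (gridSymbol L M N β (uvShiftedSymbol L M β μ θ Λ₀) σ q₀) qv =
      if (q₀ 0).val < 2 * M then ((1 / (β * (L : ℝ) ^ 2) : ℝ) : ℂ) ^ 2 *
        (uvShiftedMomentumSymbolFn (β * (L : ℝ) ^ 2) θ Λ₀ (gridFreq M N β q₀) (nambuXi L μ qv + 2 * Real.cos (latticeMomentum L qv l))
            (latticeMomentum L qv l + 2 * (2 * Real.pi / L)) -
          (2 : ℝ) • uvShiftedMomentumSymbolFn (β * (L : ℝ) ^ 2) θ Λ₀ (gridFreq M N β q₀)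
            (nambuXi L μ qv + 2 * Real.cos (latticeMomentum L qv l)) (latticeMomentum L qv l + 2 * Real.pi / L) +
          uvShiftedMomentumSymbolFn (β * (L : ℝ) ^ 2) θ Λ₀ (gridFreq M N β q₀) (nambuXi L μ qv + 2 * Real.cos (latticeMomentum L qv l))
            (latticeMomentum L qv l)) else 0 := by
  have h0 := gridSymbol_uvShiftedSymbol_add_smul_eq (μ := μ) (Λ₀ := Λ₀) (M := M) hβ hθ σ q₀ qv l 0
  rw [Nat.cast_zero, zero_mul, add_zero, zero_smul, add_zero] at h0
  rw [fwdDiff_iter_two_apply, gridSymbol_uvShiftedSymbol_add_smul_eq hβ hθ, gridSymbol_uvShiftedSymbol_add_smul_eq hβ hθ, h0]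
  split_ifs with h
  · push_cast
    rw [Complex.real_smul, one_mul]
    push_cast
    ring
  · simp

omit [NeZero N] in
/-- **Space bound**: `‖(Δ_{e_l})² G(q₀,·)(q⃗)‖ ≤ [val q₀ < 2M]·(βL²)⁻²·(2π/L)²·K′·βL²/(Λ₀(ω̃²+Λ₀²))`, `K′ = 4K + 32B₁ + 40`
(`π/β ≤ Λ₀ ≤ 1`). [cite: BenfattoGiulianiMastropietro2006, (2.36aa)] -/
theorem norm_fwdDiff_two_space_gridSymbol_uvShifted_le (hβ : 0 < β) (hθ : |β * θ| ≤ Real.pi / 4) (hΛ₀β : Real.pi / β ≤ Λ₀)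
    (hΛ₀1 : Λ₀ ≤ 1) {B₁ B₂ : ℝ} (hB₁ : ∀ x, |deriv salmhoferCutoff x| ≤ B₁) (hB₂ : ∀ x, |deriv (deriv salmhoferCutoff) x| ≤ B₂)
    (σ : Fin 2) (q₀ : TorusSite 1 N) (qv : TorusSite 2 L) (l : Fin 2) :
    ‖(fwdDiff (Pi.single l (1 : ZMod L) : TorusSite 2 L))^[2] (gridSymbol L M N β (uvShiftedSymbol L M β μ θ Λ₀) σ q₀) qv‖ ≤
      if (q₀ 0).val < 2 * M then (1 / (β * (L : ℝ) ^ 2)) ^ 2 * ((2 * Real.pi / L) ^ 2 *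
        ((4 * (32 * B₂ + 144 * B₁ + 200) + 32 * B₁ + 40) * (β * (L : ℝ) ^ 2) / (Λ₀ * (gridFreq M N β q₀ ^ 2 + Λ₀ ^ 2)))) else 0 := by
  have hL : (0 : ℝ) < L := by exact_mod_cast Nat.pos_of_ne_zero (NeZero.ne L)
  have hΛ₀ : 0 < Λ₀ := lt_of_lt_of_le (by positivity) hΛ₀β
  have hθ' : |θ| ≤ Λ₀ / 4 := abs_shift_le_quarter hβ hθ hΛ₀β
  have hB10 : 0 ≤ B₁ := (abs_nonneg _).trans (hB₁ 0)
  have hB20 : 0 ≤ B₂ := (abs_nonneg _).trans (hB₂ 0)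
  rw [fwdDiff_two_space_gridSymbol_uvShifted_eq hβ hθ]
  split_ifs with h
  · set c := β * (L : ℝ) ^ 2 with hc
    set ω := gridFreq M N β q₀ with hω
    set e₀ := nambuXi L μ qv + 2 * Real.cos (latticeMomentum L qv l) with he₀
    set p := latticeMomentum L qv l with hp
    rw [norm_mul, norm_pow, Complex.norm_real, Real.norm_eq_abs, abs_of_nonneg (by positivity)]
    refine mul_le_mul_of_nonneg_left ?_ (by positivity)
    refine Literature.Analysis.norm_second_difference_le (f := uvShiftedMomentumSymbolFn c θ Λ₀ ω e₀) (x := p) (δ := 2 * Real.pi / L)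
      (by positivity) (fun t _ => hasDerivAt_uvShiftedMomentumSymbolFn (c := c) (ω := ω) (e₀ := e₀) hΛ₀ hθ' t)
      (fun t _ => hasDerivAt_uvShiftedMomentumSymbolFnD1 (c := c) (ω := ω) (e₀ := e₀) hΛ₀ hθ' t) fun t _ => ?_
    refine (norm_uvShiftedMomentumSymbolFnD2_le hΛ₀ hΛ₀1 hθ' (by positivity) hB₁ hB₂ t).trans ?_
    refine div_le_div_of_nonneg_left (by positivity) (by positivity) ?_
    exact mul_le_mul_of_nonneg_left (by nlinarith [sq_nonneg (bandFn e₀ t)]) hΛ₀.le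
  · rw [norm_zero]

end Space

/-! ### The `ℓ²` sums -/

section Sums

variable [NeZero L] [NeZero N] {β μ θ Λ₀ : ℝ}

omit [NeZero N] in
/-- `#(ℤ/L)² = L²`. [folklore] -/
private theorem card_torusSite_two'' : Fintype.card (TorusSite 2 L) = L ^ 2 := by
  rw [Fintype.card_fun, ZMod.card, Fintype.card_fin]

/-- **`Σ_{q₀,q⃗} ‖G‖² ≤ L²·(βL²)⁻⁴·20(βL²)²·β/(2Λ₀)`** (`π/β ≤ Λ₀`, `2M ≤ N`). [cite: BenfattoGiulianiMastropietro2006, §2.8 (2.80)] -/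
theorem sum_norm_sq_gridSymbol_uvShiftedSymbol_le (hβ : 0 < β) (hθ : |β * θ| ≤ Real.pi / 4) (hΛ₀β : Real.pi / β ≤ Λ₀)
    (hMN : 2 * M ≤ N) (σ : Fin 2) :
    ∑ q₀ : TorusSite 1 N, ∑ qv : TorusSite 2 L, ‖gridSymbol L M N β (uvShiftedSymbol L M β μ θ Λ₀) σ q₀ qv‖ ^ 2 ≤
      (L : ℝ) ^ 2 * (((1 / (β * (L : ℝ) ^ 2)) ^ 2) ^ 2 * (20 * (β * (L : ℝ) ^ 2) ^ 2) * (β / (2 * Λ₀))) := by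
  have hΛ₀ : 0 < Λ₀ := lt_of_lt_of_le (by positivity) hΛ₀β
  refine (sum_le_sum fun q₀ _ => sum_le_sum fun qv _ => norm_sq_gridSymbol_uvShiftedSymbol_le hβ μ hθ hΛ₀β σ q₀ qv).trans ?_
  rw [sum_sum_window_eq hMN β (fun ω => ((1 / (β * (L : ℝ) ^ 2)) ^ 2) ^ 2 * (20 * (β * (L : ℝ) ^ 2) ^ 2 / (ω ^ 2 + Λ₀ ^ 2)))]
  refine mul_le_mul_of_nonneg_left ?_ (by positivity)
  have h := sum_matsubaraIdx_inv_sq_add_sq_le hβ hΛ₀ M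
  calc ∑ i : MatsubaraIdx M, ((1 / (β * (L : ℝ) ^ 2)) ^ 2) ^ 2 * (20 * (β * (L : ℝ) ^ 2) ^ 2 / (matsubaraFreq β M i ^ 2 + Λ₀ ^ 2))
      = ((1 / (β * (L : ℝ) ^ 2)) ^ 2) ^ 2 * (20 * (β * (L : ℝ) ^ 2) ^ 2) *
          ∑ i : MatsubaraIdx M, 1 / (matsubaraFreq β M i ^ 2 + Λ₀ ^ 2) := by
        rw [mul_sum]; exact sum_congr rfl fun i _ => by ring
    _ ≤ _ := mul_le_mul_of_nonneg_left h (by positivity)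

/-- **`Σ_{q₀,q⃗} ‖(Δ_{e_l})² G‖² ≤ L²·(βL²)⁻⁴(2π/L)⁴K′²(βL²)²/Λ₀²·β/(2Λ₀³)`** (`π/β ≤ Λ₀ ≤ 1`, `2M ≤ N`).
[cite: BenfattoGiulianiMastropietro2006, §2.8 (2.80)] -/
theorem sum_norm_sq_fwdDiff_two_space_uvShifted_le (hβ : 0 < β) (hθ : |β * θ| ≤ Real.pi / 4) (hΛ₀β : Real.pi / β ≤ Λ₀)
    (hΛ₀1 : Λ₀ ≤ 1) {B₁ B₂ : ℝ} (hB₁ : ∀ x, |deriv salmhoferCutoff x| ≤ B₁) (hB₂ : ∀ x, |deriv (deriv salmhoferCutoff) x| ≤ B₂)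
    (hMN : 2 * M ≤ N) (σ : Fin 2) (l : Fin 2) :
    ∑ q₀ : TorusSite 1 N, ∑ qv : TorusSite 2 L,
        ‖(fwdDiff (Pi.single l (1 : ZMod L) : TorusSite 2 L))^[2] (gridSymbol L M N β (uvShiftedSymbol L M β μ θ Λ₀) σ q₀) qv‖ ^ 2 ≤
      (L : ℝ) ^ 2 * (((1 / (β * (L : ℝ) ^ 2)) ^ 2) ^ 2 * (2 * Real.pi / L) ^ 4 *
        ((4 * (32 * B₂ + 144 * B₁ + 200) + 32 * B₁ + 40) * (β * (L : ℝ) ^ 2) / Λ₀) ^ 2 * (β / (2 * Λ₀ ^ 3))) := by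
  have hΛ₀ : 0 < Λ₀ := lt_of_lt_of_le (by positivity) hΛ₀β
  set K' := (4 * (32 * B₂ + 144 * B₁ + 200) + 32 * B₁ + 40) with hK'
  set c := β * (L : ℝ) ^ 2 with hc
  have hpt : ∀ (q₀ : TorusSite 1 N) (qv : TorusSite 2 L),
      ‖(fwdDiff (Pi.single l (1 : ZMod L) : TorusSite 2 L))^[2] (gridSymbol L M N β (uvShiftedSymbol L M β μ θ Λ₀) σ q₀) qv‖ ^ 2 ≤
        if (q₀ 0).val < 2 * M then
          ((1 / c) ^ 2) ^ 2 * (2 * Real.pi / L) ^ 4 * (K' * c / Λ₀) ^ 2 * (1 / (gridFreq M N β q₀ ^ 2 + Λ₀ ^ 2) ^ 2) else 0 := by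
    intro q₀ qv
    have h := norm_fwdDiff_two_space_gridSymbol_uvShifted_le (μ := μ) (M := M) (N := N) hβ hθ hΛ₀β hΛ₀1 hB₁ hB₂ σ q₀ qv l
    split_ifs at h ⊢ with hq
    · refine (pow_le_pow_left₀ (norm_nonneg _) h 2).trans (le_of_eq ?_)
      rw [← hK', ← hc]
      have hden : 0 < gridFreq M N β q₀ ^ 2 + Λ₀ ^ 2 := by positivity
      field_simp
    · rw [le_antisymm h (norm_nonneg _), zero_pow two_ne_zero]
  refine (sum_le_sum fun q₀ _ => sum_le_sum fun qv _ => hpt q₀ qv).trans ?_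
  rw [sum_sum_window_eq hMN β (fun ω => ((1 / c) ^ 2) ^ 2 * (2 * Real.pi / L) ^ 4 * (K' * c / Λ₀) ^ 2 * (1 / (ω ^ 2 + Λ₀ ^ 2) ^ 2)),
    ← mul_sum]
  exact mul_le_mul_of_nonneg_left (mul_le_mul_of_nonneg_left (sum_matsubaraIdx_inv_sq_add_sq_sq_le hβ hΛ₀ M) (by positivity))
    (by positivity)

/-- **`Σ_{q₀,q⃗} ‖(Δ_u)² G‖²`**: interior part `L²·(βL²)⁻⁴(2π/β)⁴(5K βL²/Λ₀)²·β/(2Λ₀³)` plus the four edge points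
`4·L²·(4·(βL²)⁻²·5βL²·β/(π(2M-3)))²` (`π/β ≤ Λ₀`, `4π/β ≤ Λ₀`, `2 ≤ M`, `2M ≤ N`). [cite: BenfattoGiulianiMastropietro2006, §2.8 (2.80)] -/
theorem sum_norm_sq_fwdDiff_two_time_uvShifted_le (hβ : 0 < β) (hθ : |β * θ| ≤ Real.pi / 4) (hΛ₀β : Real.pi / β ≤ Λ₀)
    (hstep : 2 * (2 * Real.pi / β) ≤ Λ₀) {B₁ B₂ : ℝ} (hB₁ : ∀ x, |deriv salmhoferCutoff x| ≤ B₁)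
    (hB₂ : ∀ x, |deriv (deriv salmhoferCutoff) x| ≤ B₂) (hM : 2 ≤ M) (hMN : 2 * M ≤ N) (σ : Fin 2) :
    ∑ q₀ : TorusSite 1 N, ∑ qv : TorusSite 2 L,
        ‖(fwdDiff (fun _ : Fin 1 => (1 : ZMod N)))^[2] (fun q => gridSymbol L M N β (uvShiftedSymbol L M β μ θ Λ₀) σ q qv) q₀‖ ^ 2 ≤
      (L : ℝ) ^ 2 * (((1 / (β * (L : ℝ) ^ 2)) ^ 2) ^ 2 * (2 * Real.pi / β) ^ 4 *
          (5 * (32 * B₂ + 144 * B₁ + 200) * (β * (L : ℝ) ^ 2) / Λ₀) ^ 2 * (β / (2 * Λ₀ ^ 3))) +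
        4 * ((L : ℝ) ^ 2 * (4 * ((1 / (β * (L : ℝ) ^ 2)) ^ 2 * (5 * (β * (L : ℝ) ^ 2) * (β / (Real.pi * (2 * M - 3)))))) ^ 2) := by
  classical
  have hΛ₀ : 0 < Λ₀ := lt_of_lt_of_le (by positivity) hΛ₀β
  set c := β * (L : ℝ) ^ 2 with hc
  set K₅ := 5 * (32 * B₂ + 144 * B₁ + 200) with hK
  set Eb := 4 * ((1 / c) ^ 2 * (5 * c * (β / (Real.pi * (2 * M - 3))))) with hEb
  set Edge := (univ : Finset (TorusSite 1 N)).filter fun q₀ =>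
    2 * M ≤ (q₀ 0).val + 2 ∧ ¬ (2 * M ≤ (q₀ 0).val ∧ (q₀ 0).val + 2 < N) with hEdge
  set F : TorusSite 1 N → TorusSite 2 L → ℂ := fun q₀ qv =>
    (fwdDiff (fun _ : Fin 1 => (1 : ZMod N)))^[2] (fun q => gridSymbol L M N β (uvShiftedSymbol L M β μ θ Λ₀) σ q qv) q₀ with hF
  have hpt : ∀ (q₀ : TorusSite 1 N) (qv : TorusSite 2 L), ‖F q₀ qv‖ ^ 2 ≤
      (if (q₀ 0).val < 2 * M then ((1 / c) ^ 2) ^ 2 * (2 * Real.pi / β) ^ 4 * (K₅ * c / Λ₀) ^ 2 *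
          (1 / (gridFreq M N β q₀ ^ 2 + Λ₀ ^ 2) ^ 2) else 0) +
        (if q₀ ∈ Edge then Eb ^ 2 else 0) := by
    intro q₀ qv
    have hden : 0 < gridFreq M N β q₀ ^ 2 + Λ₀ ^ 2 := by positivity
    by_cases hint : (q₀ 0).val + 2 < 2 * M
    · have h := norm_fwdDiff_two_time_gridSymbol_uvShifted_le_interior (μ := μ) hβ hθ hΛ₀β hstep hB₁ hB₂ hMN σ q₀ qv hint
      rw [if_pos (show (q₀ 0).val < 2 * M by omega)]
      refine le_add_of_le_of_nonneg ((pow_le_pow_left₀ (norm_nonneg _) h 2).trans (le_of_eq ?_)) (by split_ifs <;> positivity)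
      rw [← hc, ← hK]
      field_simp
    · by_cases hpad : 2 * M ≤ (q₀ 0).val ∧ (q₀ 0).val + 2 < N
      · have h0 := fwdDiff_two_time_gridSymbol_uvShifted_eq_zero_of_padding (β := β) (μ := μ) (θ := θ) (Λ₀ := Λ₀) (M := M) σ q₀ qv
          hpad.1 hpad.2
        rw [hF]; dsimp only; rw [h0, norm_zero, zero_pow two_ne_zero]
        exact add_nonneg (by split_ifs <;> positivity) (by split_ifs <;> positivity)
      · have hmem : q₀ ∈ Edge := mem_filter.2 ⟨mem_univ _, by omega, hpad⟩
        have h := norm_fwdDiff_two_time_gridSymbol_uvShifted_le_edge (μ := μ) hβ hθ hΛ₀β hM hMN σ q₀ qv (by omega)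
        rw [if_pos hmem]
        refine le_add_of_nonneg_of_le (by split_ifs <;> positivity) ?_
        rw [hEb, hc]
        exact pow_le_pow_left₀ (norm_nonneg _) h 2
  refine (sum_le_sum fun q₀ _ => sum_le_sum fun qv _ => hpt q₀ qv).trans ?_
  simp only [sum_add_distrib]
  refine add_le_add ?_ ?_
  · rw [sum_sum_window_eq hMN β (fun ω => ((1 / c) ^ 2) ^ 2 * (2 * Real.pi / β) ^ 4 * (K₅ * c / Λ₀) ^ 2 *
      (1 / (ω ^ 2 + Λ₀ ^ 2) ^ 2)), ← mul_sum]
    exact mul_le_mul_of_nonneg_left (mul_le_mul_of_nonneg_left (sum_matsubaraIdx_inv_sq_add_sq_sq_le hβ hΛ₀ M) (by positivity))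
      (by positivity)
  · have hrow : ∀ q₀ : TorusSite 1 N, ∑ _qv : TorusSite 2 L, (if q₀ ∈ Edge then Eb ^ 2 else (0 : ℝ)) =
        if q₀ ∈ Edge then (L : ℝ) ^ 2 * Eb ^ 2 else 0 := by
      intro q₀
      split_ifs
      · rw [sum_const, card_univ, card_torusSite_two'', nsmul_eq_mul, Nat.cast_pow]
      · simp
    simp_rw [hrow]
    rw [← sum_filter, Finset.filter_mem_eq_inter, Finset.univ_inter, sum_const, nsmul_eq_mul]
    have hcard : (Edge.card : ℝ) ≤ 4 := by exact_mod_cast card_timeEdge_le_four (M := M) (N := N)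
    have : (0 : ℝ) ≤ (L : ℝ) ^ 2 * Eb ^ 2 := by positivity
    calc (Edge.card : ℝ) * ((L : ℝ) ^ 2 * Eb ^ 2) ≤ 4 * ((L : ℝ) ^ 2 * Eb ^ 2) := mul_le_mul_of_nonneg_right hcard this
      _ = _ := by rw [hEb, hc]

end Sums

end Literature.MathematicalPhysics.QuantumLattice

end
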